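import Literature.Computability.AlgebraicComplexity.IK2020TableauWords
import HarnessLib

/-!
# Ikenmeyer–Kandasamy 2020, Lemma 8.1 / eq. (8.2): `γ(gT)` as a matrix coefficient of the
# Weyl module — `⟨e_{rowWord}, g · c_λ e_x⟩ = |R_λ| · ∏_c det(…)` (brick M1 of programme #4)

Typed-and-proved literature (cell `val-lit`, row IK20-A; honest framing: bookkeeping of
Ikenmeyer–Kandasamy's toy model; VP ≠ VNP is NOT proved and nothing here is progress on it).

Source: C. Ikenmeyer, U. Kandasamy, STOC 2020 = arXiv:1911.03990 [IkenmeyerKandasamy2019],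
Lemma 8.1 with eq. (8.2) (TeX L676–686; chunk p0014.txt 'Lemma 8'): "Let `T` be a Young tableau of
shape `λ` … and let `γ ∈ {λ}^*` be the vector dual to the superstandard tableau … Then
`γ(gT) = ∏_{c} det(g_{1..λᵗ_c, T(1,c)}, …, g_{1..λᵗ_c, T(λᵗ_c,c)})`". The tree takes the right-hand
side as the DEFINITION `IK2020.gammaProd` (`IK20HighestWeightVectors.lean`); this file proves the
identity that replaces the left-hand side in the tree's model of `{λ}`, namely Weyl's construction
`{λ} = c_λ · (k^m)^{⊗n}` inside the tensor power with its standard basis `e_x`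
(`x : Fin n → Fin m` a word = a filling of the boxes of `λ`, numbered row by row):

  `⟨e_{r}, g · (c_λ e_x)⟩ = |R_λ| · γ(g T_x)`,

where `r = rowWord λ` is the row word (the superstandard filling: box in row `i` carries `i`),
`c_λ = a_λ b_λ` the Young symmetrizer (`youngSymmetrizer`), `R_λ` the row stabilizer, and `T_x`
the word `x` read as a column tableau (`IK2020.wordTableau`, `IK2020TableauWords.lean`)
(`IK2020.repr_glTensorRep_youngSymmetrizer_tensorBasis_rowWord`). In words: the functional
"coordinate at `e_r`" is, up to the factor `|R_λ|`, IK's `γ` on the Weyl module, and `g ↦ γ(g T)` is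
the matrix coefficient `g ↦ ⟨e_r^*, g · c_λ e_x⟩` — the "𝔖_n-side" reading of IK's §8 which the
cell's programme #4 (architect's note `HOME/bip/NOTE-t02g6-G-discharge-sizing.md`, val-lit-t02)
uses to discharge the cite-fact `IK2020_thm_9_1_orbitFunctions` without Peter–Weyl.

Proof (Fulton, *Young Tableaux*, §8.1–8.2; IK Lemma 8.1): in coordinates
`(g · v)_r = ∑_I (∏_j g_{r_j, I_j}) v_I`, `(a_λ u)_I = ∑_{ρ ∈ R_λ} u_{I∘ρ}`,
`(b_λ e_x)_I = ∑_{σ ∈ C_λ} sgn σ [I ∘ σ = x]` (tree: `repr_glTensorRep`, `repr_rowSymmetrizer`,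
`repr_colAntisymmetrizer`); the row word is fixed by `R_λ`, so every `ρ` contributes the same term
and `⟨e_r, g c_λ e_x⟩ = |R_λ| ∑_{σ ∈ C_λ} sgn σ ∏_j g_{r(σ j), x_j}`; the signed sum over the column
stabilizer is the determinant of the block-diagonal matrix (blocks = columns of `λ`, via the box
bijection `IK2020.colPosEquiv`) whose `c`-th block is `(g_{i, x(c,r')})_{i,r' < λᵗ_c}` — the Leibniz
expansion over ALL permutations of the boxes reduces to the column-preserving ones because a
box moved to another column meets a zero entry — and a block-diagonal determinant is the product
of the blocks' determinants, i.e. `γ(g T_x)` (top rows `i < λᵗ_c`, the tree's `colTopDet`).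

## References

* [IkenmeyerKandasamy2019] C. Ikenmeyer, U. Kandasamy, STOC 2020 = arXiv:1911.03990, Lemma 8.1 /
  eq. (8.2) (L676–686), §6 (`{λ} ⊆ ⊗^{|λ|} ℂ^m`, L613–636), §9 eq. (9.4) (`g ↦ γ(gv)`).
* W. Fulton, *Young Tableaux*, LMS Student Texts 35 (1997), §8.1 (action of `GL(E)` on `E^{⊗n}`,
  `e_T · c_T`), §8.2 Lemma 4. [FultonYoungTableaux1997]

## Mathlib and tree

Tree: `tensorBasis`, `repr_glTensorRep`, `repr_rowSymmetrizer`, `repr_colAntisymmetrizer`, `rowWord`,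
`rowWord_comp_of_mem_rowStabilizer`, `rowStabilizer`, `colStabilizer`, `youngSymmetrizer`
(`SchurWeylPlethysm`, `SchurWeylHighestWeightProofs`), `IK2020.colPosEquiv`, `wordTableau`,
`rowWord_colPos` (`IK2020TableauWords`), `IK2020.colTopDet`, `gammaProd`. Mathlib:
`Matrix.det_apply'`, `Matrix.blockDiagonal'`, `Matrix.BlockTriangular.det_fintype`,
`Equiv.permCongr`, `Equiv.Perm.sign_permCongr`.
-/

noncomputable section

open scoped BigOperators

namespace Literature.Computability.AlgebraicComplexity

namespace IK2020

open Finset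
open _root_.Literature.NumberTheory.DiophantineGeometry

/-! ### §1 A block-diagonal determinant with blocks of different sizes -/

/-- `det (blockDiagonal' d) = ∏ₖ det dₖ` for square blocks of different sizes (Mathlib's
`Matrix.det_blockDiagonal` is the equal-size case; via block-triangularity along an enumeration
of the block index — the same private computation as in
`Literature/AlgebraicGeometry/HodgeTheory/WeilClassesFieldDecomposableOfMatrixBlocks.lean`).
[folklore] -/
private theorem det_blockDiagonal'_eq_prod {K : Type*} [CommRing K] {κ : Type*} [Fintype κ]
    [DecidableEq κ] {σ : κ → Type*} [∀ k, Fintype (σ k)] [∀ k, DecidableEq (σ k)]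
    (d : ∀ k, Matrix (σ k) (σ k) K) :
    (Matrix.blockDiagonal' d).det = ∏ k, (d k).det := by
  let e := Fintype.equivFin κ
  have hT : (Matrix.blockDiagonal' d).BlockTriangular (fun a : Σ j, σ j ↦ e a.1) := by
    rintro ⟨i, x⟩ ⟨j, y⟩ h
    exact Matrix.blockDiagonal'_apply_ne d x y fun hij ↦ absurd (congrArg (⇑e) hij.symm) (ne_of_lt h)
  rw [hT.det_fintype]
  refine (Fintype.prod_equiv e (fun k ↦ (d k).det) _ fun k ↦ ?_).symm
  let f₀ : σ k ≃ {a : Σ j, σ j // a.1 = k} :=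
    { toFun := fun x ↦ ⟨⟨k, x⟩, rfl⟩
      invFun := fun a ↦ a.2 ▸ a.1.2
      left_inv := fun _ ↦ rfl
      right_inv := by
        rintro ⟨⟨j, x⟩, h⟩
        subst h
        rfl }
  let f : σ k ≃ {a : Σ j, σ j // e a.1 = e k} :=
    f₀.trans (Equiv.subtypeEquivRight fun a ↦ e.injective.eq_iff.symm)
  rw [Matrix.toSquareBlock_def, ← Matrix.det_submatrix_equiv_self f]
  congr 1
  ext x y
  simp only [Matrix.submatrix_apply]
  exact (Matrix.blockDiagonal'_apply_eq d k x y).symm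

/-! ### §2 The signed sum over the column stabilizer is `γ` -/

section ColumnSum

variable {k : Type*} [CommRing k] {n m : ℕ} (lam : Nat.Partition n) (hlam : lam.parts.card ≤ m)
  (g : Matrix (Fin m) (Fin m) k) (x : Fin n → Fin m)

/-- The big matrix on the boxes of `λ` (indexed by `(column, row)`): entry `((c',i), (c,r)) ↦
g_{i, x(c,r)}` if `c' = c` and `0` otherwise — block diagonal with the blocks
`(g_{i, x(c,r')})_{i, r' < λᵗ_c}` of IK's eq. (8.2). [cite: IkenmeyerKandasamy2019, Lemma 8.1 eq. (8.2)] -/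
private theorem bigMatrix_eq_blockDiagonal' :
    (Matrix.of fun b' b : (Σ c : Fin (numCols lam), Fin (colHeight lam c)) =>
        if b'.1 = b.1 then g (Fin.castLE ((colHeight_le_card lam b'.1).trans hlam) b'.2)
          (x (colPos lam b.1 b.2)) else 0) =
      Matrix.blockDiagonal' fun c => Matrix.of fun i r : Fin (colHeight lam c) =>
        g (Fin.castLE ((colHeight_le_card lam c).trans hlam) i) (x (colPos lam c r)) := by
  ext ⟨c', i⟩ ⟨c, r⟩
  rw [Matrix.of_apply, Matrix.blockDiagonal'_apply']
  by_cases h : c' = c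
  · subst h
    rw [if_pos rfl, dif_pos rfl]
    rfl
  · rw [if_neg h, dif_neg h]

/-- The entries of the big matrix in position coordinates: for boxes `q'`, `q` (numbered by
`Fin n`), the entry is `g_{row(q'), x(q)}` if `q'` and `q` lie in the same column, else `0`.
[cite: IkenmeyerKandasamy2019, Lemma 8.1 eq. (8.2)] -/
private theorem bigMatrix_apply_symm (q' q : Fin n) :
    (Matrix.of fun b' b : (Σ c : Fin (numCols lam), Fin (colHeight lam c)) =>
        if b'.1 = b.1 then g (Fin.castLE ((colHeight_le_card lam b'.1).trans hlam) b'.2)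
          (x (colPos lam b.1 b.2)) else 0) ((colPosEquiv lam).symm q') ((colPosEquiv lam).symm q) =
      if lam.colOf q' = lam.colOf q then g (rowWord lam hlam q') (x q) else 0 := by
  rw [Matrix.of_apply]
  have hq : colPos lam ((colPosEquiv lam).symm q).1 ((colPosEquiv lam).symm q).2 = q :=
    (colPosEquiv lam).apply_symm_apply q
  rw [hq]
  have hrow : Fin.castLE ((colHeight_le_card lam ((colPosEquiv lam).symm q').1).trans hlam)
      ((colPosEquiv lam).symm q').2 = rowWord lam hlam q' :=
    Fin.ext rfl
  rw [hrow]
  have hcol : (((colPosEquiv lam).symm q').1 = ((colPosEquiv lam).symm q).1) ↔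
      lam.colOf q' = lam.colOf q := by
    rw [Fin.ext_iff, colPosEquiv_symm_apply_fst, colPosEquiv_symm_apply_fst]
  by_cases h : lam.colOf q' = lam.colOf q
  · rw [if_pos (hcol.mpr h), if_pos h]
  · rw [if_neg (fun h' => h (hcol.mp h')), if_neg h]

open scoped Classical in
/-- **The signed column sum is `γ`** (IK Lemma 8.1 / Fulton §8.1): for every word `x` and matrix `g`,
`∑_{σ ∈ C_λ} sgn(σ) ∏_j g_{r(σ j), x_j} = ∏_c det (g_{i, x(c,r')})_{i,r'} = γ(g T_x)`, `r` the row word.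
(Leibniz over all permutations of the boxes; a box moved out of its column meets a zero of the
block-diagonal matrix.) [cite: IkenmeyerKandasamy2019, Lemma 8.1 eq. (8.2)] -/
theorem sum_colStabilizer_sign_mul_prod_eq_gammaProd :
    ∑ σ : colStabilizer lam, ((Equiv.Perm.sign (σ : Equiv.Perm (Fin n)) : ℤ) : k) *
        ∏ j, g (rowWord lam hlam ((σ : Equiv.Perm (Fin n)) j)) (x j) =
      gammaProd k g (colHeight lam) (fun c => (colHeight_le_card lam c).trans hlam)
        (wordTableau lam x).entry := by
  classical
  -- the right-hand side is the determinant of the block-diagonal big matrix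
  have hdet : gammaProd k g (colHeight lam) (fun c => (colHeight_le_card lam c).trans hlam)
        (wordTableau lam x).entry =
      (Matrix.of fun b' b : (Σ c : Fin (numCols lam), Fin (colHeight lam c)) =>
        if b'.1 = b.1 then g (Fin.castLE ((colHeight_le_card lam b'.1).trans hlam) b'.2)
          (x (colPos lam b.1 b.2)) else 0).det := by
    rw [bigMatrix_eq_blockDiagonal' lam hlam g x, det_blockDiagonal'_eq_prod]
    rfl
  rw [hdet, Matrix.det_apply']
  -- Leibniz: reindex the permutations of the boxes by permutations of `Fin n`
  rw [← Equiv.sum_comp (colPosEquiv lam).symm.permCongr]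
  simp only [Equiv.Perm.sign_permCongr]
  -- the product over boxes, in position coordinates
  have hprod : ∀ σ : Equiv.Perm (Fin n),
      ∏ b : (Σ c : Fin (numCols lam), Fin (colHeight lam c)),
        (Matrix.of fun b' b : (Σ c : Fin (numCols lam), Fin (colHeight lam c)) =>
          if b'.1 = b.1 then g (Fin.castLE ((colHeight_le_card lam b'.1).trans hlam) b'.2)
            (x (colPos lam b.1 b.2)) else 0) (((colPosEquiv lam).symm.permCongr σ) b) b =
        ∏ j : Fin n,
          if lam.colOf (σ j) = lam.colOf j then g (rowWord lam hlam (σ j)) (x j) else 0 := by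
    intro σ
    rw [← Equiv.prod_comp (colPosEquiv lam).symm]
    refine Fintype.prod_congr _ _ fun j => ?_
    rw [Equiv.permCongr_apply, Equiv.symm_symm, Equiv.apply_symm_apply,
      bigMatrix_apply_symm lam hlam g x]
  simp only [hprod]
  -- split the Leibniz sum into the column-preserving permutations and the rest
  have hS : ∀ σ : Equiv.Perm (Fin n),
      σ ∈ (colStabilizer lam : Set (Equiv.Perm (Fin n))).toFinset ↔ σ ∈ colStabilizer lam :=
    fun σ => Set.mem_toFinset
  have hzero : ∀ σ ∈ (Finset.univ : Finset (Equiv.Perm (Fin n))),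
      σ ∉ (colStabilizer lam : Set (Equiv.Perm (Fin n))).toFinset →
        ((Equiv.Perm.sign σ : ℤ) : k) *
          ∏ j : Fin n, (if lam.colOf (σ j) = lam.colOf j then g (rowWord lam hlam (σ j)) (x j)
            else 0) = 0 := by
    intro σ _ hσ
    rw [hS, mem_colStabilizer_iff, not_forall] at hσ
    obtain ⟨j, hj⟩ := hσ
    rw [Finset.prod_eq_zero (Finset.mem_univ j) (if_neg hj), mul_zero]
  rw [← Finset.sum_subtype (colStabilizer lam : Set (Equiv.Perm (Fin n))).toFinset hS
      (f := fun σ : Equiv.Perm (Fin n) => ((Equiv.Perm.sign σ : ℤ) : k) *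
        ∏ j, g (rowWord lam hlam (σ j)) (x j)),
    ← Finset.sum_subset (Finset.subset_univ _) hzero]
  refine Finset.sum_congr rfl fun σ hσ => ?_
  rw [hS] at hσ
  congr 1
  refine Fintype.prod_congr _ _ fun j => ?_
  rw [if_pos (hσ j)]

end ColumnSum

/-! ### §3 The matrix coefficient `⟨e_r, g · c_λ e_x⟩` -/

section MatrixCoefficient

variable {k : Type*} [Field k] {n m : ℕ} (lam : Nat.Partition n) (hlam : lam.parts.card ≤ m)

/-- The words `I` with `I ∘ τ = x` are exactly `x ∘ τ⁻¹`. [folklore] -/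
private theorem comp_perm_eq_iff {α : Type*} (I x : Fin n → α) (τ : Equiv.Perm (Fin n)) :
    x = I ∘ ⇑τ ↔ I = x ∘ ⇑τ⁻¹ := by
  constructor
  · rintro rfl
    funext j
    simp
  · rintro rfl
    funext j
    simp

open scoped Classical in
/-- **IK Lemma 8.1 / eq. (8.2) in the tree's model of `{λ}`: `⟨e_r, g · (c_λ e_x)⟩ = |R_λ| · γ(g T_x)`.**
For a field `k`, `λ ⊢ n` with at most `m` parts, `g ∈ GL_m(k)` and a word `x : Fin n → Fin m`
(a filling of the boxes of `λ`), the `e_{rowWord λ}`-coordinate of `g · (c_λ · e_x)` in the tensor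
power `(k^m)^{⊗n}` (`c_λ = youngSymmetrizer`, acting through `permTensorRep`; `g` through
`glTensorRep`) equals `|R_λ|` times IK's `γ(g T_x) = ∏_c det (g_{i, T_x(c,r)})_{i, r < λᵗ_c}`
(`IK2020.gammaProd` of the word read as a column tableau, `IK2020.wordTableau`). Brick M1 of the
discharge of `IK2020_thm_9_1_orbitFunctions` (val-lit programme #4).
[cite: IkenmeyerKandasamy2019, Lemma 8.1 eq. (8.2)] -/
theorem repr_glTensorRep_youngSymmetrizer_tensorBasis_rowWord
    (g : GL (Fin m) k) (x : Fin n → Fin m) :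
    (tensorBasis k (Fin m) n).repr (glTensorRep (Fin m) k n g
        ((permTensorRep k (Fin m → k) n).asAlgebraHom (youngSymmetrizer k lam)
          (tensorBasis k (Fin m) n x))) (rowWord lam hlam) =
      (Fintype.card (rowStabilizer lam) : k) *
        gammaProd k (g : Matrix (Fin m) (Fin m) k) (colHeight lam)
          (fun c => (colHeight_le_card lam c).trans hlam) (wordTableau lam x).entry := by
  classical
  rw [← sum_colStabilizer_sign_mul_prod_eq_gammaProd lam hlam (g : Matrix (Fin m) (Fin m) k) x,
    repr_glTensorRep]
  -- the coordinates of `c_λ e_x = a_λ (b_λ e_x)`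
  have hcoord : ∀ I : Fin n → Fin m,
      (tensorBasis k (Fin m) n).repr ((permTensorRep k (Fin m → k) n).asAlgebraHom
        (youngSymmetrizer k lam) (tensorBasis k (Fin m) n x)) I =
      ∑ ρ : rowStabilizer lam, ∑ σ : colStabilizer lam,
        ((Equiv.Perm.sign (σ : Equiv.Perm (Fin n)) : ℤ) : k) *
          if I = x ∘ ⇑((ρ : Equiv.Perm (Fin n)) * (σ : Equiv.Perm (Fin n)))⁻¹ then 1 else 0 := by
    intro I
    rw [youngSymmetrizer, map_mul, Module.End.mul_apply, repr_rowSymmetrizer]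
    refine Finset.sum_congr rfl fun ρ _ => ?_
    rw [repr_colAntisymmetrizer]
    refine Finset.sum_congr rfl fun σ _ => ?_
    rw [Module.Basis.repr_self, Finsupp.single_apply]
    congr 1
    have : (x = (I ∘ ⇑(ρ : Equiv.Perm (Fin n))) ∘ ⇑(σ : Equiv.Perm (Fin n))) ↔
        I = x ∘ ⇑((ρ : Equiv.Perm (Fin n)) * (σ : Equiv.Perm (Fin n)))⁻¹ := by
      rw [← comp_perm_eq_iff]
      rfl
    simp only [this]
  simp only [hcoord, Finset.mul_sum]
  -- exchange the sums; every `ρ ∈ R_λ` contributes the same signed column sum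
  rw [Finset.sum_comm]
  have inner : ∀ ρ : rowStabilizer lam,
      ∑ I : Fin n → Fin m, ∑ σ : colStabilizer lam,
        (∏ j, (g : Matrix (Fin m) (Fin m) k) (rowWord lam hlam j) (I j)) *
          (((Equiv.Perm.sign (σ : Equiv.Perm (Fin n)) : ℤ) : k) *
            if I = x ∘ ⇑((ρ : Equiv.Perm (Fin n)) * (σ : Equiv.Perm (Fin n)))⁻¹ then 1 else 0) =
      ∑ σ : colStabilizer lam, ((Equiv.Perm.sign (σ : Equiv.Perm (Fin n)) : ℤ) : k) *
        ∏ j, (g : Matrix (Fin m) (Fin m) k) (rowWord lam hlam ((σ : Equiv.Perm (Fin n)) j)) (x j) := by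
    intro ρ
    rw [Finset.sum_comm]
    refine Finset.sum_congr rfl fun σ _ => ?_
    have hite : ∀ I : Fin n → Fin m,
        (∏ j, (g : Matrix (Fin m) (Fin m) k) (rowWord lam hlam j) (I j)) *
          (((Equiv.Perm.sign (σ : Equiv.Perm (Fin n)) : ℤ) : k) *
            if I = x ∘ ⇑((ρ : Equiv.Perm (Fin n)) * (σ : Equiv.Perm (Fin n)))⁻¹ then 1 else 0) =
        if I = x ∘ ⇑((ρ : Equiv.Perm (Fin n)) * (σ : Equiv.Perm (Fin n)))⁻¹ then
          ((Equiv.Perm.sign (σ : Equiv.Perm (Fin n)) : ℤ) : k) *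
            ∏ j, (g : Matrix (Fin m) (Fin m) k) (rowWord lam hlam j) (I j) else 0 := by
      intro I
      split_ifs <;> ring
    simp only [hite, Finset.sum_ite_eq', Finset.mem_univ, if_true]
    congr 1
    rw [← Equiv.prod_comp ((ρ : Equiv.Perm (Fin n)) * (σ : Equiv.Perm (Fin n)))]
    refine Fintype.prod_congr _ _ fun j => ?_
    rw [Function.comp_apply, Equiv.Perm.inv_def, Equiv.symm_apply_apply, Equiv.Perm.mul_apply]
    have hJ := congrFun (rowWord_comp_of_mem_rowStabilizer lam hlam ρ.2) ((σ : Equiv.Perm (Fin n)) j)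
    rw [Function.comp_apply] at hJ
    rw [hJ]
  simp only [inner, Finset.sum_const, Finset.card_univ, nsmul_eq_mul, Finset.mul_sum]

end MatrixCoefficient

end IK2020

end Literature.Computability.AlgebraicComplexity

end
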